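import Literature.MathematicalPhysics.QuantumFieldTheory.Balaban1983to89.T4CauchySum
import Literature.MathematicalPhysics.QuantumFieldTheory.Balaban1983to89.T4GoodClassBudget

/-!
# NE7 ideation seat (lineage t4-ne7-p2), gen 35 — step S23: the SINGLE-BLOCK instance (Q = ∅) of route W-AM′'s
# island budget (P2), typed from a displayed SPECIES DECOMPOSITION, and the K-GROWTH tolerance of W-AM′

kernel bookkeeping of the ideation seat (filed by courier, see COURIER NOTE), [folklore] real analysis only; no sentence of the
papers under audit is used as a fact.  Imports the tree's `T4CauchySum` (Mathlib) and nothing else.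

Route W-AM′ (record `t4/T4-EST-NE7-P2.md` §31–§35, T60) reduces node U5 = NE7 (`T4CauchySum.MatchingModConstants`)
to ONE unshared analytic debt (P2): TERM-WISE ISLAND BUDGETS
  `hδ : ∀ j ≤ K, ∀ z ∈ Cell K (K − j), ∀ b ∈ B K j, ∀ Q ∈ records W j K (E K j) b, δ K j z b Q ≤ φ K b · θ ^ j`
(g34 `PhiSupplier.summable_islandErr_records`), where `δ K j z b Q` is the discrepancy, MODULO A FIELD-INDEPENDENT
CONSTANT, between the two runs' logarithms of the frozen factor of an island of kind `b` born at level `j` at position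
`z` with cluster record `Q`.  This file types the case `Q = ∅` (a single block):

* §1  species algebra: if run A's island action is `x_A·W + E_A + R_A` and run B's is `x_B·W + E_B + R_B` with a COMMON
      bounded main term `W` (`|W| ≤ n_W`), couplings `|x_B − x_A| ≤ disc`, one-step functionals `|E_B − E_A| ≤ d_E` and
      boundary species `|R_B − R_A − κ| ≤ d_R` (a field-independent constant `κ` allowed), then pointwise
      `|S_B − S_A − κ| ≤ n_W·disc + d_E + d_R`;
* §2  the block lemma: over a COMMON constrained domain (weight `χ ≥ 0`, the same set of internal configurations in
      both runs — the identical-domains requirement D8 of the record, DISPLAYED not solved) the logarithms of the two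
      frozen factors match modulo `−κ` with the same remainder — ONE CALL of the tree's
      `T4CauchySum.abs_log_integral_sub_le` (the constants-quotient-out step of the cell, already in the tree);
* §3  the `hδ` SHAPE: with the coupling species at U2's rate (`T4CauchySum.InjectedRate C₂ c θ`, the tree's U2 theorem
      `T4CouplingMatching.injectedRate_of_runs` delivers exponent `c = 0`), the functional species at an NE5-type rate
      `C_E(b)·(K+1)^c·θ^j` and the boundary species at `C_R(b)·(K+1)^c·θ^j`, every single block obeys
      `δ ≤ φ_b·(K+1)^c·θ^j`, `φ_b = n_W(b)·C₂ + C_E(b) + C_R(b)`; at `c = 0` the budget is K-FREE;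
* §4  K-GROWTH TOLERANCE: the two-rate convolution `Σ_{j ≤ K} θ^j r^{K−j}` of g34 stays summable in `K` after
      multiplication by ANY polynomial `(K+1)^c` (so a kind moment `φ̄_K ≤ φ̄·(K+1)^c` — e.g. from `1/g_j² ≤ 1/g_0² = O(K)`
      or from `p₀(g_j)`-polylogs — does not kill W-AM′), while a GEOMETRIC growth `a^K` with `a·max(θ,r) ≥ 1` makes the
      majorant non-summable (the route's sharpened kill criterion, census T78);
* §5  the bounded-Wilson-term count `n_W(b) = 2·#plaquettes(b)` from `0 ≤ w_p ≤ 2` per plaquette (compact group,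
      normalised `1 − N⁻¹ Re tr`).

What §1–§3 DISPLAY and do NOT supply (located, unprinted; the row's skeleton leaves): the representation of both runs'
island integrands in the level-(j−1) expanded form (valid below the birth level; record (repr-LF)), the U2 rate of the
couplings (row U2, tree, under its `BetaLowerH`/`FadingMemory` hypotheses), the NE5-type two-run rate of the frozen
one-step functionals (row NE5), the NE3-type closeness of the exterior backgrounds (row NE3), identical constrained
domains (D8 / common classifier R1), and the kind moment `Σ_b φ_b ρ_b ≤ φ̄` (T85).

COURIER NOTE (2026-08-20, prover-b2b-balaban-t4-ne7-p3-g18-0, BINDER-OWNERS row NE7 co-owner #3): filed VERBATIM on behalf of the planner seat `b2b-balaban-t4-ne7-p2` (road W-AM′, skeleton `t4/skeletons/NE7-t4-ne7-p2.md`, its §1/§3 filing request (m1)–(m5)); content = the lineage's kernel scratch named below with ONLY the namespace moved from `T4NE7IdeasG3x` to `Summit.QuantumFields.BalabanUV.T4Continuum.WAM[.…]` and this note added; no statement changed.  Authorship and every claim in the docstrings are that seat's.  THIS FILE (m4 `WAMBlockBudget`) = `t4/b2b-balaban-t4-ne7-p2/g35/BlockBudget.lean` 86097684258244c1.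
-/

namespace Summit.QuantumFields.BalabanUV.T4Continuum.WAM.BlockBudget

open Finset MeasureTheory Filter
open Literature.MathematicalPhysics.QuantumFieldTheory.Balaban1983to89

/-! ## §1 Species algebra (pointwise) -/

/-- SPECIES DECOMPOSITION, pointwise: common bounded main term, coupling discrepancy, functional discrepancy,
boundary discrepancy modulo a constant. [folklore] -/
theorem abs_species_sub_le {xA xB W EA EB RA RB κ nW disc dE dR : ℝ}
    (hW : |W| ≤ nW) (hx : |xB - xA| ≤ disc) (hE : |EB - EA| ≤ dE) (hR : |RB - RA - κ| ≤ dR) :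
    |(xB * W + EB + RB) - (xA * W + EA + RA) - κ| ≤ nW * disc + dE + dR := by
  have h1 : |(xB - xA) * W| ≤ disc * nW := by
    rw [abs_mul]
    exact mul_le_mul hx hW (abs_nonneg _) ((abs_nonneg _).trans hx)
  have heq : (xB * W + EB + RB) - (xA * W + EA + RA) - κ = (xB - xA) * W + (EB - EA) + (RB - RA - κ) := by ring
  rw [heq]
  have h2 := abs_add_le ((xB - xA) * W + (EB - EA)) (RB - RA - κ)
  have h3 := abs_add_le ((xB - xA) * W) (EB - EA)
  nlinarith [h1, h2, h3, hE, hR, mul_comm disc nW]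

/-! ## §2 The block lemma: logarithms of the two frozen factors match modulo the constant -/

/-- **Single block, common constrained domain.**  For a common weight `χ ≥ 0` (the large-field constraint of the
island, the SAME set in both runs) and two actions with `|S_B − S_A − κ| ≤ m` pointwise, the logarithms of
`∫ χ e^{−S_B}` and `∫ χ e^{−S_A}` differ by `−κ` up to `m`.  One call of the tree's `abs_log_integral_sub_le`.
[folklore] -/
theorem blockBudget_constrained {α : Type*} [MeasurableSpace α] {μ : Measure α} {χ SA SB : α → ℝ} {κ m : ℝ}
    (hχ : ∀ ω, 0 ≤ χ ω)
    (hA : Integrable (fun ω => χ ω * Real.exp (-SA ω)) μ) (hB : Integrable (fun ω => χ ω * Real.exp (-SB ω)) μ)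
    (hpos : 0 < ∫ ω, χ ω * Real.exp (-SA ω) ∂μ) (h : ∀ ω, |SB ω - SA ω - κ| ≤ m) :
    |Real.log (∫ ω, χ ω * Real.exp (-SB ω) ∂μ) - Real.log (∫ ω, χ ω * Real.exp (-SA ω) ∂μ) - (-κ)| ≤ m := by
  have hlog : ∀ ω, |Real.log (Real.exp (-SB ω)) - Real.log (Real.exp (-SA ω)) - (-κ)| ≤ m := by
    intro ω
    rw [Real.log_exp, Real.log_exp]
    have : -SB ω - -SA ω - -κ = -(SB ω - SA ω - κ) := by ring
    rw [this, abs_neg]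
    exact h ω
  refine T4CauchySum.abs_log_integral_sub_le hA hB hpos (Eventually.of_forall fun ω => ?_)
    (Eventually.of_forall fun ω => ?_)
  · have h1 := (T4CauchySum.two_sided_of_abs_log_sub_le (Real.exp_pos (-SA ω)) (Real.exp_pos (-SB ω)) (hlog ω)).1
    have := mul_le_mul_of_nonneg_left h1 (hχ ω)
    calc Real.exp (-κ - m) * (χ ω * Real.exp (-SA ω)) = χ ω * (Real.exp (-κ - m) * Real.exp (-SA ω)) := by ring
      _ ≤ χ ω * Real.exp (-SB ω) := this
  · have h2 := (T4CauchySum.two_sided_of_abs_log_sub_le (Real.exp_pos (-SA ω)) (Real.exp_pos (-SB ω)) (hlog ω)).2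
    have := mul_le_mul_of_nonneg_left h2 (hχ ω)
    calc χ ω * Real.exp (-SB ω) ≤ χ ω * (Real.exp (-κ + m) * Real.exp (-SA ω)) := this
      _ = Real.exp (-κ + m) * (χ ω * Real.exp (-SA ω)) := by ring

/-- The unconstrained form (`χ ≡ 1`): one call of the tree's pointwise-log lemma. [folklore] -/
theorem blockBudget {α : Type*} [MeasurableSpace α] {μ : Measure α} {SA SB : α → ℝ} {κ m : ℝ}
    (hA : Integrable (fun ω => Real.exp (-SA ω)) μ) (hB : Integrable (fun ω => Real.exp (-SB ω)) μ)
    (hpos : 0 < ∫ ω, Real.exp (-SA ω) ∂μ) (h : ∀ ω, |SB ω - SA ω - κ| ≤ m) :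
    |Real.log (∫ ω, Real.exp (-SB ω) ∂μ) - Real.log (∫ ω, Real.exp (-SA ω) ∂μ) - (-κ)| ≤ m := by
  refine T4CauchySum.abs_log_integral_sub_le_of_pointwise hA hB hpos (fun ω => Real.exp_pos _)
    (fun ω => Real.exp_pos _) fun ω => ?_
  rw [Real.log_exp, Real.log_exp]
  have : -SB ω - -SA ω - -κ = -(SB ω - SA ω - κ) := by ring
  rw [this, abs_neg]
  exact h ω

/-- **Single block from species.**  The two runs' island actions in species form over a common constrained domain:
the frozen factors' logarithms match modulo `−κ` up to `n_W·disc + d_E + d_R`. [folklore] -/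
theorem blockBudget_species {α : Type*} [MeasurableSpace α] {μ : Measure α} {χ : α → ℝ} {xA xB : ℝ}
    {W EA EB RA RB : α → ℝ} {κ nW disc dE dR : ℝ} (hχ : ∀ ω, 0 ≤ χ ω)
    (hA : Integrable (fun ω => χ ω * Real.exp (-(xA * W ω + EA ω + RA ω))) μ)
    (hB : Integrable (fun ω => χ ω * Real.exp (-(xB * W ω + EB ω + RB ω))) μ)
    (hpos : 0 < ∫ ω, χ ω * Real.exp (-(xA * W ω + EA ω + RA ω)) ∂μ)
    (hW : ∀ ω, |W ω| ≤ nW) (hx : |xB - xA| ≤ disc) (hE : ∀ ω, |EB ω - EA ω| ≤ dE)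
    (hR : ∀ ω, |RB ω - RA ω - κ| ≤ dR) :
    |Real.log (∫ ω, χ ω * Real.exp (-(xB * W ω + EB ω + RB ω)) ∂μ)
      - Real.log (∫ ω, χ ω * Real.exp (-(xA * W ω + EA ω + RA ω)) ∂μ) - (-κ)| ≤ nW * disc + dE + dR :=
  blockBudget_constrained (SA := fun ω => xA * W ω + EA ω + RA ω) (SB := fun ω => xB * W ω + EB ω + RB ω) hχ hA hB
    hpos fun ω => abs_species_sub_le (hW ω) hx (hE ω) (hR ω)

/-! ## §3 The `hδ` shape of (P2) for single blocks, from species rates -/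

/-- **(P2), single blocks, from species rates.**  Index conventions of g34's `summable_islandErr_records`: `K` the run
index, `j ≤ K` the birth level, `z ∈ Cell K (K − j)` the position, `b ∈ B K j` the kind.  If every block's discrepancy
is bounded by its species (`hδ`, §2), the coupling species carries U2's injected rate with exponent `c`
(`T4CauchySum.InjectedRate C₂ c θ disc`), and the functional and boundary species carry `C_E(b)`, `C_R(b)` times the
same `(K+1)^c θ^j`, then `δ K j z b ≤ φ_b · (K+1)^c · θ^j` with `φ_b = n_W(b)·C₂ + C_E(b) + C_R(b)`. [folklore] -/
theorem hδ_single_of_species {γ ε : Type*} (Cell : ℕ → ℕ → Finset γ) (B : ℕ → ℕ → Finset ε)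
    (δ dE dR : ℕ → ℕ → γ → ε → ℝ) (nW CE CR : ε → ℝ) (disc : ℕ → ℕ → ℝ) {C₂ θ : ℝ} {c : ℕ}
    (hnW : ∀ b, 0 ≤ nW b)
    (hδ : ∀ K, ∀ j ≤ K, ∀ z ∈ Cell K (K - j), ∀ b ∈ B K j,
      δ K j z b ≤ nW b * disc K j + dE K j z b + dR K j z b)
    (hU2 : T4CauchySum.InjectedRate C₂ c θ disc)
    (hE : ∀ K, ∀ j ≤ K, ∀ z ∈ Cell K (K - j), ∀ b ∈ B K j, dE K j z b ≤ CE b * ((K : ℝ) + 1) ^ c * θ ^ j)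
    (hR : ∀ K, ∀ j ≤ K, ∀ z ∈ Cell K (K - j), ∀ b ∈ B K j, dR K j z b ≤ CR b * ((K : ℝ) + 1) ^ c * θ ^ j) :
    ∀ K, ∀ j ≤ K, ∀ z ∈ Cell K (K - j), ∀ b ∈ B K j,
      δ K j z b ≤ (nW b * C₂ + CE b + CR b) * ((K : ℝ) + 1) ^ c * θ ^ j := by
  intro K j hj z hz b hb
  have h1 : nW b * disc K j ≤ nW b * (C₂ * ((K : ℝ) + 1) ^ c * θ ^ j) :=
    mul_le_mul_of_nonneg_left (hU2 K j hj).2 (hnW b)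
  calc δ K j z b ≤ nW b * disc K j + dE K j z b + dR K j z b := hδ K j hj z hz b hb
    _ ≤ nW b * (C₂ * ((K : ℝ) + 1) ^ c * θ ^ j) + CE b * ((K : ℝ) + 1) ^ c * θ ^ j
        + CR b * ((K : ℝ) + 1) ^ c * θ ^ j := by linarith [hE K j hj z hz b hb, hR K j hj z hz b hb]
    _ = (nW b * C₂ + CE b + CR b) * ((K : ℝ) + 1) ^ c * θ ^ j := by ring

/-- **K-FREE single-block budgets** (the case the tree's U2 theorem delivers: exponent `c = 0`): literally g34's `hδ`
shape `δ K j z b ≤ φ b * θ ^ j` with `φ b = n_W(b)·C₂ + C_E(b) + C_R(b)` independent of `K`. [folklore] -/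
theorem hδ_single_Kfree {γ ε : Type*} (Cell : ℕ → ℕ → Finset γ) (B : ℕ → ℕ → Finset ε)
    (δ dE dR : ℕ → ℕ → γ → ε → ℝ) (nW CE CR : ε → ℝ) (disc : ℕ → ℕ → ℝ) {C₂ θ : ℝ}
    (hnW : ∀ b, 0 ≤ nW b)
    (hδ : ∀ K, ∀ j ≤ K, ∀ z ∈ Cell K (K - j), ∀ b ∈ B K j,
      δ K j z b ≤ nW b * disc K j + dE K j z b + dR K j z b)
    (hU2 : T4CauchySum.InjectedRate C₂ 0 θ disc)
    (hE : ∀ K, ∀ j ≤ K, ∀ z ∈ Cell K (K - j), ∀ b ∈ B K j, dE K j z b ≤ CE b * θ ^ j)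
    (hR : ∀ K, ∀ j ≤ K, ∀ z ∈ Cell K (K - j), ∀ b ∈ B K j, dR K j z b ≤ CR b * θ ^ j) :
    ∀ K, ∀ j ≤ K, ∀ z ∈ Cell K (K - j), ∀ b ∈ B K j, δ K j z b ≤ (nW b * C₂ + CE b + CR b) * θ ^ j := by
  intro K j hj z hz b hb
  have h := hδ_single_of_species Cell B δ dE dR nW CE CR disc hnW hδ hU2
    (fun K j hj z hz b hb => by simpa using hE K j hj z hz b hb)
    (fun K j hj z hz b hb => by simpa using hR K j hj z hz b hb) K j hj z hz b hb
  simpa using h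

/-! ## §4 K-growth tolerance of the two-rate convolution (route W-AM′'s sharpened kill criterion) -/

-- (courier re-cut, gate `dedup.landed`): the lineage's `sum_range_twoRate_le` restated the landed
-- `T4GoodClassBudget.sum_pow_mul_pow_le`; the copy is deleted and the landed declaration is used below.

/-- **Polynomial K-growth is tolerated**: `K ↦ (K+1)^c · Σ_{j ≤ K} θ^j r^{K−j}` is summable for `θ, r ∈ [0,1[` and
every `c : ℕ` (dominated by `(K+1)^{c+1} max(θ,r)^K`, the tree's `summable_succ_pow_mul_geometric`). [folklore] -/
theorem summable_twoRate_poly (c : ℕ) {θ r : ℝ} (hθ0 : 0 ≤ θ) (hθ1 : θ < 1) (hr0 : 0 ≤ r) (hr1 : r < 1) :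
    Summable fun K : ℕ => ((K : ℝ) + 1) ^ c * ∑ j ∈ range (K + 1), θ ^ j * r ^ (K - j) := by
  have hq0 : 0 ≤ max θ r := hθ0.trans (le_max_left θ r)
  have hq1 : max θ r < 1 := max_lt hθ1 hr1
  refine Summable.of_nonneg_of_le (fun K => ?_) (fun K => ?_) (T4CauchySum.summable_succ_pow_mul_geometric hq0 hq1 (c + 1))
  · exact mul_nonneg (pow_nonneg (by positivity) _)
      (Finset.sum_nonneg fun _ _ => mul_nonneg (pow_nonneg hθ0 _) (pow_nonneg hr0 _))
  · calc ((K : ℝ) + 1) ^ c * ∑ j ∈ range (K + 1), θ ^ j * r ^ (K - j)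
        ≤ ((K : ℝ) + 1) ^ c * (((K : ℝ) + 1) * (max θ r) ^ K) :=
          mul_le_mul_of_nonneg_left (Literature.MathematicalPhysics.QuantumFieldTheory.Balaban1983to89.T4GoodClassBudget.sum_pow_mul_pow_le hθ0 hr0 K) (pow_nonneg (by positivity) _)
      _ = ((K : ℝ) + 1) ^ (c + 1) * (max θ r) ^ K := by ring

/-- Drop-in for g34's `summable_islandErr_records` with a POLYNOMIALLY GROWING kind moment: any nonnegative error
sequence dominated by `C·(K+1)^c·Σ_{j ≤ K} θ^j r^{K−j}` is summable. [folklore] -/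
theorem summable_of_le_poly_twoRate {u : ℕ → ℝ} {C θ r : ℝ} {c : ℕ} (hu0 : ∀ K, 0 ≤ u K)
    (hu : ∀ K, u K ≤ C * (((K : ℝ) + 1) ^ c * ∑ j ∈ range (K + 1), θ ^ j * r ^ (K - j)))
    (hθ0 : 0 ≤ θ) (hθ1 : θ < 1) (hr0 : 0 ≤ r) (hr1 : r < 1) : Summable u :=
  Summable.of_nonneg_of_le hu0 hu ((summable_twoRate_poly c hθ0 hθ1 hr0 hr1).mul_left C)

/-- **Geometric K-growth kills the majorant**: if the kind moment grows like `a^K` with `a·q ≥ 1` (`q = max(θ,r)`),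
the geometric majorant `(a q)^K` is NOT summable.  (Only the majorant — the honest form of the kill criterion: a
geometric loss in `K` must be paid elsewhere or the route is dead at (P2).) [folklore] -/
theorem not_summable_of_geometric_growth {a q : ℝ} (ha : 0 ≤ a) (hq : 0 ≤ q) (h : 1 ≤ a * q) :
    ¬ Summable fun K : ℕ => a ^ K * q ^ K := by
  intro hs
  have hs' : Summable fun K : ℕ => (a * q) ^ K := hs.congr fun K => (mul_pow a q K).symm
  have hlt := summable_geometric_iff_norm_lt_one.mp hs'
  rw [Real.norm_of_nonneg (mul_nonneg ha hq)] at hlt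
  linarith

/-! ## §5 The bounded main term: `n_W(b) = 2·#plaquettes(b)` -/

/-- The common Wilson-type main term of a block is a sum of plaquette terms each in `[0, 2]` (normalised
`1 − N⁻¹ Re tr U_p` for unitary `U_p`), hence `|W| ≤ 2·#plaquettes`. [folklore] -/
theorem abs_wilson_le_two_card {π α : Type*} (P : Finset π) (w : π → α → ℝ)
    (hw0 : ∀ p ∈ P, ∀ ω, 0 ≤ w p ω) (hw2 : ∀ p ∈ P, ∀ ω, w p ω ≤ 2) (ω : α) :
    |∑ p ∈ P, w p ω| ≤ 2 * (P.card : ℝ) := by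
  rw [abs_of_nonneg (Finset.sum_nonneg fun p hp => hw0 p hp ω)]
  calc ∑ p ∈ P, w p ω ≤ ∑ _p ∈ P, (2 : ℝ) := Finset.sum_le_sum fun p hp => hw2 p hp ω
    _ = 2 * (P.card : ℝ) := by rw [Finset.sum_const, nsmul_eq_mul, mul_comm]

/-- For the normalised trace term: `0 ≤ 1 − x ≤ 2` whenever `|x| ≤ 1` (`x = N⁻¹ Re tr U_p`, `U_p` unitary). [folklore] -/
theorem wilsonTerm_mem {x : ℝ} (hx : |x| ≤ 1) : 0 ≤ 1 - x ∧ 1 - x ≤ 2 := by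
  rw [abs_le] at hx
  constructor <;> linarith [hx.1, hx.2]

/-! ## §6 Sanity: the K-free case composes with §4 at `c = 0` -/

example {θ r : ℝ} (hθ0 : 0 ≤ θ) (hθ1 : θ < 1) (hr0 : 0 ≤ r) (hr1 : r < 1) :
    Summable fun K : ℕ => ∑ j ∈ range (K + 1), θ ^ j * r ^ (K - j) := by
  simpa using summable_twoRate_poly 0 hθ0 hθ1 hr0 hr1

end Summit.QuantumFields.BalabanUV.T4Continuum.WAM.BlockBudget
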